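import Mathlib
import HarnessLib
import Summits.HubbardSuperconductivity.HubbardSuperconductivity.Theorems.KLProgrammeKLRegimeTwoVolumeSrcTowerInductionF
import Summits.HubbardSuperconductivity.HubbardSuperconductivity.Theorems.KLProgrammeKLRegimeTwoVolumeSrcTowerBlockFA

/-!
# Route `KLProgramme` — crux K3, VL child `KLRegimeVolumeLimitV17F3` (stmt-HubbardSuperconductivity-23356), producer route «(VL)-SRC-SOFT» §S5b-3 at a
# GENERIC SOURCE FAMILY with E1's degree-2 law RE-TYPED at `ε_{n_β+1}` (cure (c1) of «(VL)-HE1-LEVEL0-DEG2»; seat hubbard-kl-k3c4-p1 g20; `--supports` 23356)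

Twin of `…TwoVolumeSrcTowerInductionF.sourceProfilesAtLevF_allLevels` (p684296) in which E1's alive read-out is asked law-shaped only in the degrees `2d ≥ 4` at every
level (`hS₀law`), while the DEGREE-2 values obey `S₀ j 2 ≤ C₀·Q₁.CE·lamMax·4^{−(j+1)}` (`hS₀two`; `lamMax ≥ ε_{N+1}` — the certified `O(ε_{n_β+1})` shape of p3 g20's
F7, «(VL)-HE1-LEVEL0-DEG2» cure (c1)); the block step is `…SrcTowerBlockFA.sourceProfilesAtLevF_blockStep'` with `aal := C₀·Q₁.CE·lamMax`, and the rows/amplitude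
closed forms carry `aal` in the `a`-slot.  Otherwise the landed proof verbatim.

* **`sourceProfilesAtLevF_allLevels'`** — token #24-F at every level `j ≤ N` with the amplitude `A j s := W^{3^j}`.

Proof only; no definition; nothing about the model's sizes is asserted beyond the hypotheses.
References: BGM 2006 §2.8 (2.77)–(2.83), §3 (3.2)–(3.8) [cite: BenfattoGiulianiMastropietro2006]; Gawȩdzki–Kupiainen 1985 §3 [cite: GawedzkiKupiainen1985GrossNeveu].
-/

noncomputable section

namespace Summit.HubbardSuperconductivity.HubbardSuperconductivity.Theorems.TwoVolumeDefect

set_option linter.dupNamespace false -- summit = problem name (single-conjunct summit), D-0017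

open Real Finset Literature.MathematicalPhysics.QuantumLattice GrassmannAlgebra Literature.Probability.LatticeModels
open Literature.Probability.LatticeModels.BattleFederbush
open Summit.HubbardSuperconductivity.HubbardSuperconductivity.Theorems.KLProgrammeLegKernels
open Summit.HubbardSuperconductivity.HubbardSuperconductivity.Theorems.KLRegimeSplit
open Summit.HubbardSuperconductivity.HubbardSuperconductivity.Theorems.EngineV8
open Summit.HubbardSuperconductivity.HubbardSuperconductivity.Theorems.TwoVolumeSource

variable {L M : ℕ} [NeZero L] [NeZero M]

set_option maxHeartbeats 1600000 in -- long binder block (the `set` abbreviations are matched inside the closed forms)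
open Classical in
/-- **THE SOURCE TOWER AT ALL LEVELS (fixed `L, M`, frame `K`).**  Hypotheses: packages `Q₁` (alive), `Q_R` (per-pair `R`, reproduced across blocks), `Q_o` (report);
`0 < ε_1`, `ε_{N+1} ≤ λ_max ≤ 1`; `Z_{k+1} ≠ 0` (`k ≤ N`); for every block bottom `k ≥ 1` and length `1 ≤ ℓ ≤ d′` with `k + ℓ ≤ N` the block data (Gram `κ` with
`κ²8^{k+1} = 2Cκe₀`, rows/cols `α = Cb(M/β)/Λ_{k+1+ℓ}`, overlap rows `cr = 81CJ·M/β` and columns `cc = 81·2^ℓ·CJ′·M/β`, all at the rate `k+ℓ`); the alive read-out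
`S₀ j` with its law at every `j ≤ N`; token #24 at the levels `0, 1` with amplitude `A₀` and per-pair `R` (the UV atom); the rows of T2₂ at `λ_max` for every `ℓ ≤ d′`;
the per-pair conditions `cc′(ℓ)²ΓR ≤ 8^ℓ·Q_o.CE` (`ℓ ≤ d′`), `cc′(d′)²Γ ≤ 8^{d′}` and `R ≤ Q_o.CE`; the amplitude base `W ≥ A₀`, `W ≥ 16·max(1, G)`.
Conclusion: token #24 at every level `j ≤ N` within `klSrcBudget P Q_o U (fun i _ => W^{3^i}) (j+1)`.
[cite: BenfattoGiulianiMastropietro2006, §2.8 (2.77)-(2.83), §3 (3.2)-(3.8); cite: GawedzkiKupiainen1985GrossNeveu, §3] -/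
theorem sourceProfilesAtLevF_allLevels' {β : ℝ} (hβ : 0 < β) (U μ : ℝ) (K : TrigPolyC4v) (F : Fin 1 → FreqMomentum L M → ℂ) {d' N : ℕ} (hd' : 1 ≤ d')
    (P : SplitConsts) (hKl : 0 ≤ P.Klam) (Q₁ QR Qo : EngConsts) (hQ₁ : 0 ≤ Q₁.CE) (hR0 : 0 < QR.CE) (hQ₁R : Q₁.CE ≤ QR.CE) (hRQo : QR.CE ≤ Qo.CE)
    {C₀ t₀ lamMax : ℝ} (hC₀ : 0 ≤ C₀) (ht₀ : 0 < t₀) (ht₀1 : t₀ ≤ 1)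
    (hlampos : 0 < epsCoupling P U 1) (hlamMax : epsCoupling P U (N + 1) ≤ lamMax) (hlamMax1 : lamMax ≤ 1)
    (hZ : ∀ k, k ≤ N → hubbardEffPartitionFnCT L M β U μ 0 K (klScale klE0 (k + 1)) ≠ 0)
    {Cκ Cb CJ CJ' θ : ℝ} (hCκ : 0 < Cκ) (hCb : 0 < Cb) (hθ : 0 < θ)
    (hdata : ∀ k ℓ : ℕ, 1 ≤ k → 1 ≤ ℓ → ℓ ≤ d' → k + ℓ ≤ N → ∃ κ α cr cc : ℝ, 0 < κ ∧ κ ^ 2 * (8 : ℝ) ^ (k + 1) = 2 * Cκ * klE0 ∧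
      α = Cb * ((M : ℝ) / β) / klScale klE0 (k + 1 + ℓ) ∧ cr = 81 * CJ * M / β ∧ cc = 81 * (2 : ℝ) ^ ℓ * CJ' * M / β ∧
      IsGramBoundedR ((sectorSubMatrix L M β (bgmFatMultiplier L M klE0 β (nambuXiCT L μ K) k)).transpose *
        hubbardCovSliceCT L M β μ 0 K (klScale klE0 (k + 1 + ℓ)) (klScale klE0 (k + 1)) *
          sectorSubMatrix L M β (bgmFatMultiplier L M klE0 β (nambuXiCT L μ K) k)) κ ∧
      (∀ X, ∑ Y, ‖((sectorSubMatrix L M β (bgmFatMultiplier L M klE0 β (nambuXiCT L μ K) k)).transpose *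
        hubbardCovSliceCT L M β μ 0 K (klScale klE0 (k + 1 + ℓ)) (klScale klE0 (k + 1)) *
          sectorSubMatrix L M β (bgmFatMultiplier L M klE0 β (nambuXiCT L μ K) k)) X Y‖ *
        klScaleWt L M β (k + ℓ) {latticeLegPos (2 * (2 * M)) X, latticeLegPos (2 * (2 * M)) Y} ≤ α) ∧
      (∀ Y, ∑ X, ‖((sectorSubMatrix L M β (bgmFatMultiplier L M klE0 β (nambuXiCT L μ K) k)).transpose *
        hubbardCovSliceCT L M β μ 0 K (klScale klE0 (k + 1 + ℓ)) (klScale klE0 (k + 1)) *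
          sectorSubMatrix L M β (bgmFatMultiplier L M klE0 β (nambuXiCT L μ K) k)) X Y‖ *
        klScaleWt L M β (k + ℓ) {latticeLegPos (2 * (2 * M)) X, latticeLegPos (2 * (2 * M)) Y} ≤ α) ∧
      (∀ X'', ∑ X', ‖(sectorAnalysisMatrix L M β (klAnisoFamily L M β μ K klE0 (k + ℓ)) *
        sectorSubMatrix L M β (bgmFatMultiplier L M klE0 β (nambuXiCT L μ K) k)) X'' X'‖ *
        klScaleWt L M β (k + ℓ) {latticeLegPos (2 * (2 * M)) X'', latticeLegPos (2 * (2 * M)) X'} ≤ cr) ∧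
      (∀ X', ∑ X'', ‖(sectorAnalysisMatrix L M β (klAnisoFamily L M β μ K klE0 (k + ℓ)) *
        sectorSubMatrix L M β (bgmFatMultiplier L M klE0 β (nambuXiCT L μ K) k)) X'' X'‖ *
        klScaleWt L M β (k + ℓ) {latticeLegPos (2 * (2 * M)) X'', latticeLegPos (2 * (2 * M)) X'} ≤ cc))
    -- the engine's alive read-out at every level (`stub_vl_HE1free`)
    (S₀ : ℕ → ℕ → ℝ) (hS₀0 : ∀ j m, 0 ≤ S₀ j m) (hS₀law : ∀ j, j ≤ N → ∀ d, 2 ≤ d → S₀ j (2 * d) ≤ C₀ * klWtBudget P Q₁ U (j + 1) (2 * d))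
    (hS₀two : ∀ j, j ≤ N → S₀ j 2 ≤ C₀ * Q₁.CE * lamMax * ((4 : ℝ) ^ (j + 1))⁻¹)
    (hS₀read : ∀ j, j ≤ N → ∀ (m : ℕ) (q : Fin m) (w : SpaceTimeIdx L M × SectorLeg (sectorCount j)),
      klWtPinnedSumAt L M β μ K j j m (klEffectiveAction L M β U μ K klE0 (j + 1)) q w ≤ S₀ j m)
    -- token #24 at the levels `0, 1` (the UV atom)
    {A₀ : ℝ} (hUV : ∀ j, j ≤ 1 → SourceProfilesAtLevF L M (klSrcBudget P QR U (fun _ _ => A₀) (j + 1)) β U μ K F j j (j + 1))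
    -- the rows of T2₂ at `λ_max`
    (hx₂ : 2 * lamMax * (Real.exp 1 ^ 4 * (1 + θ) ^ 2 * (2 * Cκ * klE0)) * QR.CE ≤ 1)
    (hx₁ : 4 * (2 * Cκ * klE0) * lamMax * QR.CE ≤ 1 / 2)
    (hx₃ : Real.exp 1 * (Real.exp 1 ^ 4 * (1 + θ) ^ 2 * (2 * Cκ * klE0)) * lamMax * QR.CE ≤ 1 / 2)
    (hw : ∀ ℓ : ℕ, 1 ≤ ℓ → ℓ ≤ d' → (256 * Real.exp 1 * Cb * (4 : ℝ) ^ ℓ / Cκ) * (2 * (Real.exp 1 ^ 4 * (1 + θ) ^ 2 * (2 * Cκ * klE0)) * QR.CE *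
      (lamMax * (C₀ * Q₁.CE / (2 * QR.CE) + 2 * t₀ / 2) + ((2 * t₀ + C₀ * Q₁.CE * lamMax) / (2 * QR.CE) + C₀ * (Q₁.CE / QR.CE) ^ 2 + 2 * t₀))) ≤ 1 / 2)
    (hV : ∀ ℓ : ℕ, 1 ≤ ℓ → ℓ ≤ d' → (256 * Real.exp 1 * Cb * (4 : ℝ) ^ ℓ / Cκ) *
      (Real.exp 1 * (Real.exp 1 ^ 4 * (1 + θ) ^ 2 * (2 * Cκ * klE0)) * (lamMax * (C₀ * Q₁.CE + 2 * t₀ * QR.CE) + (2 * t₀ + C₀ * Q₁.CE * lamMax)) +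
        4 * lamMax * (Real.exp 1 * (Real.exp 1 ^ 4 * (1 + θ) ^ 2 * (2 * Cκ * klE0))) ^ 2 * (C₀ * Q₁.CE ^ 2 + 2 * t₀ * QR.CE ^ 2)) ≤ 1 / 2)
    -- per-pair constants: report (`Q_o`) and reproduction (`R`)
    (hQoR : ∀ ℓ : ℕ, 1 ≤ ℓ → ℓ ≤ d' →
      max (81 * (2 : ℝ) ^ ℓ * CJ' / 2) 1 ^ 2 * max 4 (2 * (Real.exp 1 ^ 4 * (1 + θ) ^ 2 * (2 * Cκ * klE0)) * (1 / (θ ^ 2 * (2 * Cκ * klE0)))) *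
        QR.CE ≤ (8 : ℝ) ^ ℓ * Qo.CE)
    (hRR : max (81 * (2 : ℝ) ^ d' * CJ' / 2) 1 ^ 2 * max 4 (2 * (Real.exp 1 ^ 4 * (1 + θ) ^ 2 * (2 * Cκ * klE0)) * (1 / (θ ^ 2 * (2 * Cκ * klE0)))) *
        QR.CE ≤ (8 : ℝ) ^ d' * QR.CE)
    -- the amplitude base
    {W : ℝ} (hA₀W : A₀ ≤ W)
    (hW : 16 * max 1 ((max (81 * CJ / 2) 1 * max (81 * (2 : ℝ) ^ d' * CJ' / 2) 1 * (2 : ℝ) ^ (5 * d') *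
        (max 4 (2 * (Real.exp 1 ^ 4 * (1 + θ) ^ 2 * (2 * Cκ * klE0)) * (1 / (θ ^ 2 * (2 * Cκ * klE0)))) * QR.CE *
            ((C₀ + 2 * t₀) * (1 + 8 * (2 * Cκ * klE0) * QR.CE) +
              Real.exp 1 * (C₀ * Q₁.CE / (2 * QR.CE) + 2 * t₀ / 2 + ((2 * t₀ + C₀ * Q₁.CE * lamMax) / (2 * QR.CE) + C₀ * (Q₁.CE / QR.CE) ^ 2 + 2 * t₀))) +
          ((C₀ + 2 * t₀) * (1 + 8 * (2 * Cκ * klE0) * QR.CE) +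
              Real.exp 1 * (C₀ * Q₁.CE / (2 * QR.CE) + 2 * t₀ / 2 + ((2 * t₀ + C₀ * Q₁.CE * lamMax) / (2 * QR.CE) + C₀ * (Q₁.CE / QR.CE) ^ 2 + 2 * t₀))) +
          (2 * t₀ + C₀ * Q₁.CE * lamMax))) / t₀ ^ 2) ≤ W) :
    ∀ j, j ≤ N → SourceProfilesAtLevF L M (klSrcBudget P Qo U (fun i _ => W ^ 3 ^ i) (j + 1)) β U μ K F j j (j + 1) := by
  -- abbreviations
  set τc : ℝ := Real.exp 1 ^ 4 * (1 + θ) ^ 2 * (2 * Cκ * klE0) with hτc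
  set ψc : ℝ := 1 / (θ ^ 2 * (2 * Cκ * klE0)) with hψc
  set σc : ℝ := 2 * Cκ * klE0 with hσc
  set R : ℝ := QR.CE with hRdef
  set Γ : ℝ := max 4 (2 * τc * ψc) with hΓ
  set cr' : ℝ := max (81 * CJ / 2) 1 with hcr'
  set Kt : ℝ := (C₀ + 2 * t₀) * (1 + 8 * σc * R) +
    Real.exp 1 * (C₀ * Q₁.CE / (2 * R) + 2 * t₀ / 2 + ((2 * t₀ + C₀ * Q₁.CE * lamMax) / (2 * R) + C₀ * (Q₁.CE / R) ^ 2 + 2 * t₀)) with hKt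
  set G : ℝ := cr' * max (81 * (2 : ℝ) ^ d' * CJ' / 2) 1 * (2 : ℝ) ^ (5 * d') * (Γ * R * Kt + Kt + (2 * t₀ + C₀ * Q₁.CE * lamMax)) / t₀ ^ 2 with hGdef
  have he : (0 : ℝ) < klE0 := by norm_num [klE0]
  have hlamMax0 : 0 ≤ lamMax := hlampos.le.trans ((epsCoupling_mono hKl U (by omega : 1 ≤ N + 1)).trans hlamMax)
  have haal0 : 0 ≤ C₀ * Q₁.CE * lamMax := by positivity
  have hσ0 : 0 < σc := by positivity
  have hΓ0 : 0 ≤ Γ := le_trans (by norm_num) (le_max_left _ _)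
  have hcr'0 : 0 ≤ cr' := zero_le_one.trans (le_max_right _ _)
  have hKt0 : 0 ≤ Kt := by positivity
  have hG0 : 0 ≤ G := by
    have : (0 : ℝ) ≤ max (81 * (2 : ℝ) ^ d' * CJ' / 2) 1 := zero_le_one.trans (le_max_right _ _)
    positivity
  have hW1 : 1 ≤ W := by
    have h16 : (16 : ℝ) ≤ 16 * max 1 G := by nlinarith [le_max_left 1 G]
    linarith
  have hW0 : 0 ≤ W := zero_le_one.trans hW1
  have hWmono : ∀ {a b : ℕ}, a ≤ b → W ^ 3 ^ a ≤ W ^ 3 ^ b := fun hab => pow_le_pow_right₀ hW1 (Nat.pow_le_pow_right (by norm_num) hab)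
  have hWge1 : ∀ a : ℕ, 1 ≤ W ^ 3 ^ a := fun a => one_le_pow₀ hW1
  have hAmp0 : ∀ j s : ℕ, (0 : ℝ) ≤ (fun i _ => W ^ 3 ^ i : ℕ → ℕ → ℝ) j s := fun j _ => pow_nonneg hW0 _
  -- the block step with the amplitude function `W^{3^i}`
  have hstep : ∀ k ℓ : ℕ, 1 ≤ k → 1 ≤ ℓ → ℓ ≤ d' → k + ℓ ≤ N →
      SourceProfilesAtLevF L M (klSrcBudget P QR U (fun i _ => W ^ 3 ^ i) (k + 1)) β U μ K F k k (k + 1) →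
      ∀ Qx : EngConsts, 0 ≤ Qx.CE →
        max (81 * (2 : ℝ) ^ ℓ * CJ' / 2) 1 ^ 2 * max 4 (2 * τc * ψc) * R ≤ (8 : ℝ) ^ ℓ * Qx.CE →
      SourceProfilesAtLevF L M (klSrcBudget P Qx U (fun i _ => W ^ 3 ^ i) (k + ℓ + 1)) β U μ K F (k + ℓ) (k + ℓ) (k + ℓ + 1) := by
    intro k ℓ hk hℓ hℓd hkℓ hin Qx hQx hQxR
    obtain ⟨κ, α, cr, cc, hκ, hσ8, hα, hcr, hcc, hGB, hrow, hcol, hrow', hcol'⟩ := hdata k ℓ hk hℓ hℓd hkℓ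
    have hlamk0 : 0 < epsCoupling P U (k + 1) := lt_of_lt_of_le hlampos (epsCoupling_mono hKl U (by omega))
    have hlamk : epsCoupling P U (k + 1) ≤ lamMax := (epsCoupling_mono hKl U (by omega : k + 1 ≤ N + 1)).trans hlamMax
    refine sourceProfilesAtLevF_blockStep' hβ U μ K F (k := k) (ℓ := ℓ) hℓ P hKl Q₁ QR Qx hQ₁ hR0 hQ₁R hQx hC₀ ht₀ ht₀1 hlamk0 hlamk hlamMax1
      (hZ k (by omega)) hCκ hCb hθ hκ hσ8 hα hcr hcc hGB hrow hcol hrow' hcol' (S₀ k) (hS₀0 k) (hS₀law k (by omega))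
      (aal := C₀ * Q₁.CE * lamMax) haal0 (hS₀two k (by omega)) (hS₀read k (by omega))
      (Ak := W ^ 3 ^ (k + 1)) (by positivity) hin hx₂ hx₁ hx₃ (hw ℓ hℓ hℓd) (hV ℓ hℓ hℓd) hQxR (Aout := W ^ 3 ^ (k + ℓ + 1)) ?_
    -- the amplitude inequality: `16^{k+1}·W^{2·3^{k+1}}/t₀²·X(ℓ) ≤ 16^{k+2}·G·W^{2·3^{k+1}} ≤ W^{3^{k+2}} ≤ W^{3^{k+ℓ+1}}`
    rw [max_eq_right (hWge1 (k + 1))]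
    have hcc' : max (81 * (2 : ℝ) ^ ℓ * CJ' / 2) 1 ≤ max (81 * (2 : ℝ) ^ d' * CJ' / 2) 1 := by
      rcases lt_or_ge CJ' 0 with hCJ' | hCJ'
      swap
      · exact max_le_max (by gcongr; norm_num) le_rfl
      · refine max_le (le_trans ?_ (le_max_right _ _)) (le_max_right _ _)
        have : 81 * (2 : ℝ) ^ ℓ * CJ' / 2 ≤ 0 := by
          have h2 : (0 : ℝ) < 81 * (2 : ℝ) ^ ℓ := by positivity
          nlinarith
        linarith
    have h25 : (2 : ℝ) ^ (5 * ℓ) ≤ (2 : ℝ) ^ (5 * d') := pow_le_pow_right₀ (by norm_num) (by omega)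
    have hX : cr' * max (81 * (2 : ℝ) ^ ℓ * CJ' / 2) 1 * (2 : ℝ) ^ (5 * ℓ) * (Γ * R * Kt + Kt + (2 * t₀ + C₀ * Q₁.CE * lamMax)) ≤ G * t₀ ^ 2 := by
      rw [hGdef, div_mul_cancel₀ _ (by positivity)]
      have h0 : 0 ≤ Γ * R * Kt + Kt + (2 * t₀ + C₀ * Q₁.CE * lamMax) := by positivity
      gcongr
    calc (16 : ℝ) ^ (k + 1) * (W ^ 3 ^ (k + 1)) ^ 2 / t₀ ^ 2 * (cr' * max (81 * (2 : ℝ) ^ ℓ * CJ' / 2) 1 * (2 : ℝ) ^ (5 * ℓ) * (Γ * R * Kt + Kt + (2 * t₀ + C₀ * Q₁.CE * lamMax)))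
        ≤ (16 : ℝ) ^ (k + 1) * (W ^ 3 ^ (k + 1)) ^ 2 / t₀ ^ 2 * (G * t₀ ^ 2) := mul_le_mul_of_nonneg_left hX (by positivity)
      _ = (16 : ℝ) ^ (k + 1) * G * W ^ (2 * 3 ^ (k + 1)) := by rw [← pow_mul, mul_comm (3 ^ (k + 1)) 2]; field_simp
      _ ≤ (16 : ℝ) ^ (k + 1 + 1) * G * W ^ (2 * 3 ^ (k + 1)) := by gcongr <;> norm_num
      _ ≤ W ^ 3 ^ (k + 1 + 1) := amp_dominate hW (k + 1)
      _ ≤ W ^ 3 ^ (k + ℓ + 1) := hWmono (by omega)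
  -- the block bottoms `B_i = 1 + d′·i`
  have hbot : ∀ i : ℕ, 1 + d' * i ≤ N →
      SourceProfilesAtLevF L M (klSrcBudget P QR U (fun i _ => W ^ 3 ^ i) (1 + d' * i + 1)) β U μ K F (1 + d' * i) (1 + d' * i) (1 + d' * i + 1) := by
    intro i
    induction i with
    | zero =>
      intro _
      simp only [Nat.mul_zero, Nat.add_zero]
      exact (hUV 1 le_rfl).mono fun s m => klSrcBudget_mono_A P QR U hR0.le hKl (fun j _ => hA₀W.trans (le_self_pow₀ hW1 (by positivity))) _ s m
    | succ i ih =>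
      intro hN
      have hN' : 1 + d' * i + d' ≤ N := by rw [Nat.mul_succ] at hN; omega
      have h := hstep (1 + d' * i) d' (by omega) hd' le_rfl hN' (ih (by omega)) QR hR0.le hRR
      have e : 1 + d' * (i + 1) = 1 + d' * i + d' := by ring
      rw [e]
      exact h
  -- every level
  intro j hj
  rcases Nat.lt_or_ge j 2 with hj2 | hj2
  · -- the UV levels `0, 1`, re-reported
    refine ((hUV j (by omega)).mono fun s m => ?_)
    exact (klSrcBudget_mono_A P QR U hR0.le hKl (A' := fun i _ => W ^ 3 ^ i) (fun i _ => hA₀W.trans (le_self_pow₀ hW1 (by positivity))) _ s m).trans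
      (klSrcBudget_mono_CE P U hAmp0 hR0.le hRQo hKl _ s m)
  · -- `j = B_i + ℓ`, `1 ≤ ℓ ≤ d′`
    have hd'0 : 0 < d' := hd'
    obtain ⟨i, ℓ, hℓ1, hℓd, rfl⟩ : ∃ i ℓ : ℕ, 1 ≤ ℓ ∧ ℓ ≤ d' ∧ j = 1 + d' * i + ℓ := by
      refine ⟨(j - 2) / d', (j - 2) % d' + 1, by omega, Nat.succ_le_of_lt (Nat.mod_lt _ hd'0), ?_⟩
      have := Nat.div_add_mod (j - 2) d'
      omega
    exact hstep (1 + d' * i) ℓ (by omega) hℓ1 hℓd hj (hbot i (by omega)) Qo (hR0.le.trans hRQo) (hQoR ℓ hℓ1 hℓd)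

end Summit.HubbardSuperconductivity.HubbardSuperconductivity.Theorems.TwoVolumeDefect

end
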